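/-
Copyright: the b2b-balaban T⁴-continuum CRUX team, row NE7b OWNER lineage `t4-ne7b-p1` (gen 134). Project licence.
-/
import Summits.QuantumFields.BalabanUV.T4Continuum.Spine.NE7b.SupPolymerLocalExpansion
import Summits.QuantumFields.BalabanUV.T4Continuum.Spine.NE7b.SupClusterSupportRegrouping
import Summits.QuantumFields.BalabanUV.T4Continuum.Spine.NE7b.SupLocalisedPolymerGas

/-!
# THE ROAD'S STEP IN ONE FORMAT — POLYMER-LOCAL IN, POLYMER-LOCAL OUT, WITH THE EXTERNAL FIELD: for a finite family `𝒳` of `R`-connected cell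
# sets with factors `f_X` measurable in the cells of `X` and LOCAL in the field (`f_X(ω+ψ)` sees `ψ` only on the cells of `X`), singletons
# regulated (`‖f_{p}(ω)‖ ≤ εe^{½κΣ_{cell p}ω²}`), larger sets sup-small (`‖f_X‖ ≤ ε^{#X}`), over the Gaussian road `N(0,Γ)` (`Γ ⪯ γ_op·1` of range
# `ρ`, diagonal `≤ γ`, disjoint cells of `≤ v` sites, `κ(1+τ)γ_op ≤ θ < 1`) and an external field SMALL ON THE SINGLETON MEMBERS' CELLS
# (`Σ_{cell p}ψ² ≤ Ψ²` for `{p} ∈ 𝒳`), the shifted partition function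
#   `Z_ψ(𝒳) = ∫∏_{X∈𝒳}(1 + f_X(ω+ψ))dN(0,Γ)(ω) = exp(Σ_{Y ∈ 𝒫(⋃𝒳)} K⁺_Y(ψ)) ≠ 0`,  `K⁺_Y(ψ) = Σ_{𝒞 ⊆ L, ⋃𝒞 = Y}Φ^T_ψ(𝒞)`,
# with the OUTPUT TERMS `K⁺_Y(ψ)` indexed by the CONNECTED cell sets `Y ⊆ ⋃𝒳`, LOCAL in `ψ` (`ψ = ψ'` on the cells of `Y` ⟹ `K⁺_Y(ψ) = K⁺_Y(ψ')`),
# EXPONENTIALLY SMALL (`‖K⁺_Y(ψ)‖ ≤ e^{−τ₂#Y}(Δ+1)2e^{1+τ₂}ε′`), of `O(ε′)` pinned weighted norm, and summing to `‖Σ_Y K⁺_Y(ψ)‖ ≤ #(⋃𝒳)(Δ+1)2eε′`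
# — `ε′ = √ε″e^{2√ε″}`, `ε″ = ε_Ψ·A_τ^v`, `ε_Ψ = εe^{½κ(1+τ⁻¹)Ψ²}`, `A_τ = (1−θ)^{−κ(1+τ)γ∕(2θ)}`: the polymer-local input class of SCOPING-d5 IS
# mapped to a polymer-local output class by the road's fluctuation step (same sites), (353) + (354) + (296)'s cut-off and shift bookkeeping
# BY NAME (row NE7b, node U5c; [folklore])

Cell `pub-balaban`, sub-cell `t4`, spine estimate NE7b (`T4WeightBudget.RelWeightBound`; the cell's OWN estimate — NOT PRINTED in
[Bałaban 1983–89], NOT PROVED).  Crux-route work under `Spine/NE7b/` by the row OWNER (`t4-ne7b-p1` gen 134, file (355)) under FREEZE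
(0)'s crux-prover clause, on `g131/records/SCOPING-d5-reentry.md` DECISION (3) («that file is the road's first genuine recursion W ↦ W⁺»);
NOTHING of Bałaban's is named as a Lean object, valued or asserted; no `T4Continuum/Support` leaf typed; no `def`, no notation; zero `sorry`.
Imports (BY NAME): the OWNER's (353) `…SupPolymerLocalExpansion` (`pushforward_eq_zero_of_not_rconn`, `pushforward_congr_of_agree`,
`letters_of_smallness`, `eps'_nonneg`, `gaussian_setPertZ_ne_zero`, `gaussian_exp_setLogZ`, `gaussian_norm_setLogZ_le`), (354)
`…SupClusterSupportRegrouping` (`polymerLogZ_eq_sum_support`, `supportTerm_congr`, `norm_supportTerm_le`, `sum_norm_supportTerm_weighted_le`), (296)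
`…SupLocalisedPolymerGas` (`pertZ_cutoff`, `cellActivity_cutoff_of_subset`, `shifted_regulated_of_small_on` — instantiated with the cell INDEX `Finset V`
and the cell map `X ↦ ⋃_{p∈X}cell p`), (351) (`norm_setActivity_le_singletons`), (350) (`abs_pushforwardActivity_le`), (349)
(`image_biUnion_subset_rconn`), (289) (`one_le_regulatorCost`); Mathlib's `MeasurableSpace.comap_iSup`, `iSup₂_mono`, `measurable_add_const`.

WHAT IS PROVED ([folklore]; `z_ψ := ⋃_*M_ψ` on `L := (𝒫^{Touches R}(𝒳)).image ⋃`, `M_ψ(𝒜) = ∫∏_{X∈𝒜}f_X(ω+ψ)dN(0,Γ)`):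
* §1 shift ∕ cut-off bookkeeping on cell SETS: **`shifted_measurable_sets`** (the shift is measurable for the join σ-algebra `⨆_{p∈X}σ(ω|_{cell p})`),
  `cutoff_shifted_measurable_sets`, `cutoff_shifted_reg` (singleton letter with `ε_Ψ`, `κ(1+τ)`), `cutoff_shifted_sup` (`ε^{#X} ≤ ε_Ψ^{#X}`),
  `pushforward_cutoff` (cutting the factors off outside `𝒳` does not change `z_ψ`);
* §2 THE LETTERS OF `z_ψ`: **`shifted_activity_letter`** (`|M_ψ(𝒜)| ≤ ∏_{X∈𝒜}ε″^{#X}` on `𝒜 ⊆ 𝒳`), `smallness_of_letters` (`eε′(Δ+1)² ≤ 1∕2 ⟹` the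
  letters of (350)), **`shifted_pushforward_letters`** (`hz0` and `‖z_ψ(Y)‖ ≤ ε′^{#Y}`);
* §3 THE STEP: **`step_pertZ_ne_zero`**, **`step_exp_sum_support`** (`exp(Σ_{Y∈𝒫(⋃𝒳)}K⁺_Y(ψ)) = Z_ψ(𝒳)`), **`step_supportTerm_local`** (locality in
  `ψ`, NO smallness needed), **`step_norm_supportTerm_le`**, **`step_sum_norm_supportTerm_weighted_le`**, **`step_norm_sum_support_le`**; §4 toy.

HONEST (what this is NOT).  Same sites and same Gaussian (blocking ∕ rescaling and the composition of fluctuation covariances along (310)'s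
semigroup are not touched: NC-NE7b-α UNRULED); the output letter is a norm letter per support at FIXED small `ψ` — the REGULATED format of the
input singletons (growth `e^{½κΣψ²}` for large `ψ`, stability) and the measurability of `ψ ↦ K⁺_Y(ψ)` are NOT re-derived for the output here
(the former needs the large-field machinery (304)–(309)∕(343)–(344) per support term, the latter a Fubini bookkeeping as in (344)); the reality ∕
positivity of `Z_ψ` for real factors `> −1` is (306)'s bridge, not repeated; scalar skeleton ((A3)); nothing of Bałaban's asserted.  BY-NAME EFFECT
ON THE WALL: NONE.  NE7b NOT PRINTED ∕ NOT PROVED; spine PROVED 0∕9; rung (B)+1 — the programme's measures remain FINITE-torus statements; NOT the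
mass gap, NOT Clay.  HONEST DEPENDENCY: continuum YM on T⁴ ⇐ BetaPertH ∧ nine spine estimates (0∕9 proved); BetaPertH ⇐ (D1) ∧ (D4) ∧ CAP+tail;
G-an2-4 gates asym, D1 and NE2∕3∕4.
-/

set_option autoImplicit false

noncomputable section

namespace Summit.QuantumFields.BalabanUV.T4Continuum.NE7b.SupPolymerLocalStep

open MeasureTheory ProbabilityTheory Finset Real
open scoped BigOperators
open Literature.Probability.LatticeModels
open Literature.Analysis.Matrix (HasFiniteRange)
open SupLocalisedPolymerGas (pertZ_cutoff cellActivity_cutoff_of_subset shifted_regulated_of_small_on)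
open SupPolymerLocalExpansion (pushforward_eq_zero_of_not_rconn pushforward_congr_of_agree letters_of_smallness eps'_nonneg
  gaussian_setPertZ_ne_zero gaussian_exp_setLogZ gaussian_norm_setLogZ_le)
open SupPolymerLocalResummation (image_biUnion_subset_rconn)
open SupPolymerLocalSmallness (abs_pushforwardActivity_le)
open SupPolymerLocalActivityBound (norm_setActivity_le_singletons)
open SupRegulatedActivityBound (one_le_regulatorCost)
open SupClusterSupportRegrouping (polymerLogZ_eq_sum_support supportTerm_congr norm_supportTerm_le sum_norm_supportTerm_weighted_le)

variable {V : Type*} [DecidableEq V] {R : V → V → Prop} [DecidableRel R] {nbr : V → Finset V} {Δ : ℕ}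
variable {ι : Type} [Fintype ι] [DecidableEq ι]

/-! ## §1. Shift and cut-off bookkeeping on cell sets -/

omit [DecidableEq V] [Fintype ι] [DecidableEq ι] in
/-- **THE SHIFT IS MEASURABLE FOR THE JOIN σ-ALGEBRA OF A CELL SET**: if `f_X` is `⨆_{p∈X}σ(ω|_{cell p})`-measurable, so is `ω ↦ f_X(ω + ψ)`
(the restriction of a shift is the shift of the restriction, cell by cell; `comap` commutes with `⨆`). [folklore] -/
theorem shifted_measurable_sets (cell : V → Finset ι) {f : Finset V → EuclideanSpace ℝ ι → ℂ} {X : Finset V}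
    (hmeas : Measurable[⨆ p ∈ X, MeasurableSpace.comap (fun (ω : EuclideanSpace ℝ ι) (x : cell p) => ω x) inferInstance] (f X))
    (ψ : EuclideanSpace ℝ ι) :
    Measurable[⨆ p ∈ X, MeasurableSpace.comap (fun (ω : EuclideanSpace ℝ ι) (x : cell p) => ω x) inferInstance] (fun ω => f X (ω + ψ)) := by
  have hTp : ∀ p : V, Measurable[MeasurableSpace.comap (fun (ω : EuclideanSpace ℝ ι) (x : cell p) => ω x) inferInstance,
      MeasurableSpace.comap (fun (ω : EuclideanSpace ℝ ι) (x : cell p) => ω x) inferInstance] (fun ω : EuclideanSpace ℝ ι => ω + ψ) := by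
    intro p
    set rp : EuclideanSpace ℝ ι → (cell p → ℝ) := fun ω x => ω x with hrp
    rw [measurable_iff_comap_le, MeasurableSpace.comap_comp]
    have hcomp : rp ∘ (fun ω : EuclideanSpace ℝ ι => ω + ψ) = (fun g : cell p → ℝ => g + rp ψ) ∘ rp := by
      funext ω
      ext x
      simp [hrp]
    rw [hcomp, ← MeasurableSpace.comap_comp]
    exact MeasurableSpace.comap_mono (measurable_iff_comap_le.1 (measurable_add_const (rp ψ)))
  have hT : Measurable[⨆ p ∈ X, MeasurableSpace.comap (fun (ω : EuclideanSpace ℝ ι) (x : cell p) => ω x) inferInstance,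
      ⨆ p ∈ X, MeasurableSpace.comap (fun (ω : EuclideanSpace ℝ ι) (x : cell p) => ω x) inferInstance]
      (fun ω : EuclideanSpace ℝ ι => ω + ψ) := by
    rw [measurable_iff_comap_le]
    simp only [MeasurableSpace.comap_iSup]
    exact iSup₂_mono fun p _ => measurable_iff_comap_le.1 (hTp p)
  exact hmeas.comp hT

omit [Fintype ι] [DecidableEq ι] in
/-- The cut-off shifted factors are measurable in the cells of their set when the factors of `𝒳` are. [folklore] -/
theorem cutoff_shifted_measurable_sets (cell : V → Finset ι) {f : Finset V → EuclideanSpace ℝ ι → ℂ} (𝒳 : Finset (Finset V))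
    (hmeas : ∀ X ∈ 𝒳, Measurable[⨆ p ∈ X, MeasurableSpace.comap (fun (ω : EuclideanSpace ℝ ι) (x : cell p) => ω x) inferInstance] (f X))
    (ψ : EuclideanSpace ℝ ι) (X : Finset V) :
    Measurable[⨆ p ∈ X, MeasurableSpace.comap (fun (ω : EuclideanSpace ℝ ι) (x : cell p) => ω x) inferInstance]
      (fun ω => if X ∈ 𝒳 then f X (ω + ψ) else 0) := by
  by_cases hX : X ∈ 𝒳
  · simp only [hX, if_true]; exact shifted_measurable_sets cell (hmeas X hX) ψ
  · simp only [hX, if_false]; exact measurable_const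

omit [Fintype ι] in
/-- **The singleton letter, shifted and cut off**: factors of the singleton members regulated with `(ε, κ)`, the external field with
`Σ_{cell p}ψ² ≤ Ψ²` on the singleton members, `0 < τ` ⟹ the cut-off shifted factor of every `X` with `#X = 1` is regulated with
`(ε_Ψ, κ(1+τ))`, `ε_Ψ = εe^{½κ(1+τ⁻¹)Ψ²}` ((296)'s `shifted_regulated_of_small_on` with the cell index `Finset V`). [folklore] -/
theorem cutoff_shifted_reg (cell : V → Finset ι) {f : Finset V → EuclideanSpace ℝ ι → ℂ} {ε κ τ Ψ : ℝ} (hε : 0 ≤ ε) (hκ : 0 ≤ κ)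
    (hτ : 0 < τ) (𝒳 : Finset (Finset V))
    (hreg : ∀ X ∈ 𝒳, X.card = 1 → ∀ ω : EuclideanSpace ℝ ι, ‖f X ω‖ ≤ ε ^ X.card * exp (κ * (∑ x ∈ X.biUnion cell, ω x ^ 2) / 2))
    (ψ : EuclideanSpace ℝ ι) (hψ : ∀ X ∈ 𝒳, X.card = 1 → ∑ x ∈ X.biUnion cell, ψ x ^ 2 ≤ Ψ ^ 2) (X : Finset V) (hX1 : X.card = 1)
    (ω : EuclideanSpace ℝ ι) :
    ‖(if X ∈ 𝒳 then f X (ω + ψ) else 0)‖ ≤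
      (ε * exp (κ * (1 + τ⁻¹) * Ψ ^ 2 / 2)) ^ X.card * exp (κ * (1 + τ) * (∑ x ∈ X.biUnion cell, ω x ^ 2) / 2) := by
  rw [hX1, pow_one]
  split_ifs with hX
  · exact shifted_regulated_of_small_on (V := Finset V) (fun X : Finset V => X.biUnion cell) (g := f) hε hκ hτ
      (𝒳.filter fun X => X.card = 1)
      (fun X hX' ω => by
        obtain ⟨hX𝒳, hX1'⟩ := mem_filter.1 hX'
        have h := hreg X hX𝒳 hX1' ω
        rwa [hX1', pow_one] at h)
      ψ (fun X hX' => hψ X (mem_filter.1 hX').1 (mem_filter.1 hX').2) X (mem_filter.2 ⟨hX, hX1⟩) ω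
  · rw [norm_zero]; positivity

omit [Fintype ι] [DecidableEq ι] in
/-- **The sup letter, shifted and cut off**: `‖f_X‖ ≤ ε^{#X}` for the non-singleton members ⟹ the cut-off shifted factor of every `X` with `#X ≠ 1`
has `‖·‖ ≤ ε_Ψ^{#X}` (`ε ≤ ε_Ψ`). [folklore] -/
theorem cutoff_shifted_sup {f : Finset V → EuclideanSpace ℝ ι → ℂ} {ε κ τ Ψ : ℝ} (hε : 0 ≤ ε) (hκ : 0 ≤ κ)
    (hτ : 0 < τ) (𝒳 : Finset (Finset V)) (hsup : ∀ X ∈ 𝒳, X.card ≠ 1 → ∀ ω : EuclideanSpace ℝ ι, ‖f X ω‖ ≤ ε ^ X.card)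
    (ψ : EuclideanSpace ℝ ι) (X : Finset V) (hX1 : X.card ≠ 1) (ω : EuclideanSpace ℝ ι) :
    ‖(if X ∈ 𝒳 then f X (ω + ψ) else 0)‖ ≤ (ε * exp (κ * (1 + τ⁻¹) * Ψ ^ 2 / 2)) ^ X.card := by
  split_ifs with hX
  · exact (hsup X hX hX1 (ω + ψ)).trans
      (pow_le_pow_left₀ hε (le_mul_of_one_le_right hε (one_le_exp (by positivity))) _)
  · rw [norm_zero]; positivity

omit [DecidableRel R] in
/-- **Cutting the factors off outside `𝒳` does not change the resummed activity** (every family of `𝒫(𝒳)` lies inside `𝒳`). [folklore] -/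
theorem pushforward_cutoff {Ω : Type*} [MeasurableSpace Ω] (μ : Measure Ω) (g : Finset V → Ω → ℂ) (𝒳 : Finset (Finset V)) (Y : Finset V) :
    pushforwardActivity (fun 𝒜 : Finset (Finset V) => 𝒜.biUnion id) (cellActivity μ fun X ω => if X ∈ 𝒳 then g X ω else 0)
        (rconnSubsets (Touches R) 𝒳) Y =
      pushforwardActivity (fun 𝒜 : Finset (Finset V) => 𝒜.biUnion id) (cellActivity μ g) (rconnSubsets (Touches R) 𝒳) Y :=
  pushforward_congr_of_agree 𝒳 Y fun _ h𝒜 _ => cellActivity_cutoff_of_subset μ g h𝒜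

/-! ## §2. The letters of the shifted resummed activity -/

/-- **THE ACTIVITY LETTER OF THE SHIFTED FAMILIES**: `Γ ⪰ 0`, `Γ ⪯ γ_op·1`, diagonal `≤ γ` (`γ ≥ 0`); disjoint cells of `≤ v` sites; singleton members
regulated `(ε, κ)`, the other members sup-small; `0 ≤ ε`, `0 ≤ κ`, `0 < τ`, `0 < θ < 1`, `κ(1+τ)γ_op ≤ θ`; `Σ_{cell p}ψ² ≤ Ψ²` on the singleton members ⟹
for every `𝒜 ⊆ 𝒳`: `|M_ψ(𝒜)| = |∫∏_{X∈𝒜}f_X(ω+ψ)dN(0,Γ)| ≤ ∏_{X∈𝒜}(ε_Ψ·A_τ^v)^{#X}`. [folklore] -/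
theorem shifted_activity_letter {Γ : Matrix ι ι ℝ} {γop γ : ℝ} (hΓ : Γ.PosSemidef) (hΓop : (γop • (1 : Matrix ι ι ℝ) - Γ).PosSemidef)
    (hdiag : ∀ i, Γ i i ≤ γ) (hγ : 0 ≤ γ) (cell : V → Finset ι) (hdisj : ∀ p q, p ≠ q → Disjoint (cell p) (cell q)) {v : ℕ}
    (hv : ∀ p, (cell p).card ≤ v) {f : Finset V → EuclideanSpace ℝ ι → ℂ} {ε κ τ θ Ψ : ℝ} (hε : 0 ≤ ε) (hκ : 0 ≤ κ) (hτ : 0 < τ)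
    (hθ0 : 0 < θ) (hθ1 : θ < 1) (hκθ : κ * (1 + τ) * γop ≤ θ) (𝒳 : Finset (Finset V))
    (hreg : ∀ X ∈ 𝒳, X.card = 1 → ∀ ω : EuclideanSpace ℝ ι, ‖f X ω‖ ≤ ε ^ X.card * exp (κ * (∑ x ∈ X.biUnion cell, ω x ^ 2) / 2))
    (hsup : ∀ X ∈ 𝒳, X.card ≠ 1 → ∀ ω : EuclideanSpace ℝ ι, ‖f X ω‖ ≤ ε ^ X.card) (ψ : EuclideanSpace ℝ ι)
    (hψ : ∀ X ∈ 𝒳, X.card = 1 → ∑ x ∈ X.biUnion cell, ψ x ^ 2 ≤ Ψ ^ 2) (𝒜 : Finset (Finset V)) (h𝒜 : 𝒜 ⊆ 𝒳) :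
    ‖cellActivity (multivariateGaussian 0 Γ) (fun X ω => f X (ω + ψ)) 𝒜‖ ≤
      ∏ X ∈ 𝒜, ((ε * exp (κ * (1 + τ⁻¹) * Ψ ^ 2 / 2)) * ((1 - θ) ^ (-(κ * (1 + τ) * γ / (2 * θ)))) ^ v) ^ X.card := by
  rw [← cellActivity_cutoff_of_subset (multivariateGaussian 0 Γ) (fun X ω => f X (ω + ψ)) h𝒜]
  have hκ' : 0 ≤ κ * (1 + τ) := by positivity
  exact norm_setActivity_le_singletons hΓ hΓop hdiag hγ cell hdisj hv (mul_nonneg hε (exp_pos _).le) hκ' hθ0 hθ1 hκθ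
    (fun X hX1 ω => cutoff_shifted_reg cell hε hκ hτ 𝒳 hreg ψ hψ X hX1 ω)
    (fun X hX1 ω => cutoff_shifted_sup hε hκ hτ 𝒳 hsup ψ X hX1 ω) 𝒜

omit [DecidableEq V] [DecidableRel R] in
/-- `0 ≤ ε″ = ε_Ψ·A_τ^v`. [folklore] -/
theorem eps''_nonneg {ε κ τ θ Ψ γ : ℝ} {v : ℕ} (hε : 0 ≤ ε) (hκ : 0 ≤ κ) (hτ : 0 < τ) (hγ : 0 ≤ γ) (hθ0 : 0 < θ) (hθ1 : θ < 1) :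
    0 ≤ (ε * exp (κ * (1 + τ⁻¹) * Ψ ^ 2 / 2)) * ((1 - θ) ^ (-(κ * (1 + τ) * γ / (2 * θ)))) ^ v := by
  have hκγ : 0 ≤ κ * (1 + τ) * γ := by positivity
  exact mul_nonneg (mul_nonneg hε (exp_pos _).le) (pow_nonneg (zero_le_one.trans (one_le_regulatorCost hκγ hθ0 hθ1)) _)

/-- **`hz0` AND THE SMALLNESS LETTER OF THE SHIFTED RESUMMED ACTIVITY**: under the hypotheses of `shifted_activity_letter`, `R` symmetric with `≤ Δ`
neighbours, members of `𝒳` `R`-connected, and `e·ε′·(Δ+1)² ≤ 1∕2` (`ε′ = √ε″e^{2√ε″}`) ⟹ `z_ψ` vanishes off the `R`-connected sets and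
`‖z_ψ(Y)‖ ≤ ε′^{#Y}` for every `Y`. [folklore] -/
theorem shifted_pushforward_letters {Γ : Matrix ι ι ℝ} {γop γ : ℝ} (hΓ : Γ.PosSemidef) (hΓop : (γop • (1 : Matrix ι ι ℝ) - Γ).PosSemidef)
    (hdiag : ∀ i, Γ i i ≤ γ) (hγ : 0 ≤ γ) (cell : V → Finset ι) (hdisj : ∀ p q, p ≠ q → Disjoint (cell p) (cell q)) {v : ℕ}
    (hv : ∀ p, (cell p).card ≤ v) (hRsymm : ∀ x y, R x y → R y x) (hΔ : ∀ x, (nbr x).card ≤ Δ) (hnbr : ∀ x y, R x y → y ∈ nbr x)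
    {f : Finset V → EuclideanSpace ℝ ι → ℂ} {ε κ τ θ Ψ : ℝ} (hε : 0 ≤ ε) (hκ : 0 ≤ κ) (hτ : 0 < τ)
    (hθ0 : 0 < θ) (hθ1 : θ < 1) (hκθ : κ * (1 + τ) * γop ≤ θ) (𝒳 : Finset (Finset V)) (hconn : ∀ X ∈ 𝒳, IsRConnected R X)
    (hreg : ∀ X ∈ 𝒳, X.card = 1 → ∀ ω : EuclideanSpace ℝ ι, ‖f X ω‖ ≤ ε ^ X.card * exp (κ * (∑ x ∈ X.biUnion cell, ω x ^ 2) / 2))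
    (hsup : ∀ X ∈ 𝒳, X.card ≠ 1 → ∀ ω : EuclideanSpace ℝ ι, ‖f X ω‖ ≤ ε ^ X.card) (ψ : EuclideanSpace ℝ ι)
    (hψ : ∀ X ∈ 𝒳, X.card = 1 → ∑ x ∈ X.biUnion cell, ψ x ^ 2 ≤ Ψ ^ 2)
    (hsmall : Real.exp 1 * (Real.sqrt ((ε * exp (κ * (1 + τ⁻¹) * Ψ ^ 2 / 2)) * ((1 - θ) ^ (-(κ * (1 + τ) * γ / (2 * θ)))) ^ v) *
      Real.exp (2 * Real.sqrt ((ε * exp (κ * (1 + τ⁻¹) * Ψ ^ 2 / 2)) * ((1 - θ) ^ (-(κ * (1 + τ) * γ / (2 * θ)))) ^ v))) *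
      ((Δ : ℝ) + 1) ^ 2 ≤ 1 / 2) :
    (∀ Y, ¬ IsRConnected R Y →
      pushforwardActivity (fun 𝒜 : Finset (Finset V) => 𝒜.biUnion id)
        (cellActivity (multivariateGaussian 0 Γ) fun X ω => f X (ω + ψ)) (rconnSubsets (Touches R) 𝒳) Y = 0) ∧
    ∀ Y, ‖pushforwardActivity (fun 𝒜 : Finset (Finset V) => 𝒜.biUnion id)
        (cellActivity (multivariateGaussian 0 Γ) fun X ω => f X (ω + ψ)) (rconnSubsets (Touches R) 𝒳) Y‖ ≤
      (Real.sqrt ((ε * exp (κ * (1 + τ⁻¹) * Ψ ^ 2 / 2)) * ((1 - θ) ^ (-(κ * (1 + τ) * γ / (2 * θ)))) ^ v) *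
        Real.exp (2 * Real.sqrt ((ε * exp (κ * (1 + τ⁻¹) * Ψ ^ 2 / 2)) * ((1 - θ) ^ (-(κ * (1 + τ) * γ / (2 * θ)))) ^ v))) ^ Y.card := by
  obtain ⟨hs1, hε1⟩ := letters_of_smallness hsmall
  exact ⟨fun Y hY => pushforward_eq_zero_of_not_rconn 𝒳 hconn _ Y hY,
    abs_pushforwardActivity_le hRsymm hΔ hnbr 𝒳 hconn (eps''_nonneg hε hκ hτ hγ hθ0 hθ1) hε1
      (shifted_activity_letter hΓ hΓop hdiag hγ cell hdisj hv hε hκ hτ hθ0 hθ1 hκθ 𝒳 hreg hsup ψ hψ) hs1⟩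

/-! ## §3. THE STEP: polymer-local in, polymer-local out -/

/-- **THE STEP (i) — ZERO-FREENESS**: in addition `Γ` of range `ρ` for `dι` with `R` covering `ρ`-closeness and the factors of `𝒳` measurable in the
cells of their sets ⟹ `Z_ψ(𝒳) = ∫∏_{X∈𝒳}(1 + f_X(ω+ψ))dN(0,Γ) ≠ 0`. [folklore] -/
theorem step_pertZ_ne_zero {Γ : Matrix ι ι ℝ} {γop γ : ℝ} (hΓ : Γ.PosSemidef) (hΓop : (γop • (1 : Matrix ι ι ℝ) - Γ).PosSemidef)
    (hdiag : ∀ i, Γ i i ≤ γ) (hγ : 0 ≤ γ) {dι : ι → ι → ℕ} {ρ : ℕ} (hfr : HasFiniteRange dι ρ Γ) (cell : V → Finset ι)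
    (hdisj : ∀ p q, p ≠ q → Disjoint (cell p) (cell q)) {v : ℕ} (hv : ∀ p, (cell p).card ≤ v) (hRsymm : ∀ x y, R x y → R y x)
    (hR : ∀ (p p' : V) (x y : ι), x ∈ cell p → y ∈ cell p' → dι x y ≤ ρ → p = p' ∨ R p p')
    (hΔ : ∀ x, (nbr x).card ≤ Δ) (hnbr : ∀ x y, R x y → y ∈ nbr x)
    {f : Finset V → EuclideanSpace ℝ ι → ℂ} {ε κ τ θ Ψ : ℝ} (hε : 0 ≤ ε) (hκ : 0 ≤ κ) (hτ : 0 < τ) (hθ0 : 0 < θ) (hθ1 : θ < 1)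
    (hκθ : κ * (1 + τ) * γop ≤ θ) (𝒳 : Finset (Finset V)) (hconn : ∀ X ∈ 𝒳, IsRConnected R X)
    (hmeas : ∀ X ∈ 𝒳, Measurable[⨆ p ∈ X, MeasurableSpace.comap (fun (ω : EuclideanSpace ℝ ι) (x : cell p) => ω x) inferInstance] (f X))
    (hreg : ∀ X ∈ 𝒳, X.card = 1 → ∀ ω : EuclideanSpace ℝ ι, ‖f X ω‖ ≤ ε ^ X.card * exp (κ * (∑ x ∈ X.biUnion cell, ω x ^ 2) / 2))
    (hsup : ∀ X ∈ 𝒳, X.card ≠ 1 → ∀ ω : EuclideanSpace ℝ ι, ‖f X ω‖ ≤ ε ^ X.card) (ψ : EuclideanSpace ℝ ι)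
    (hψ : ∀ X ∈ 𝒳, X.card = 1 → ∑ x ∈ X.biUnion cell, ψ x ^ 2 ≤ Ψ ^ 2)
    (hsmall : Real.exp 1 * (Real.sqrt ((ε * exp (κ * (1 + τ⁻¹) * Ψ ^ 2 / 2)) * ((1 - θ) ^ (-(κ * (1 + τ) * γ / (2 * θ)))) ^ v) *
      Real.exp (2 * Real.sqrt ((ε * exp (κ * (1 + τ⁻¹) * Ψ ^ 2 / 2)) * ((1 - θ) ^ (-(κ * (1 + τ) * γ / (2 * θ)))) ^ v))) *
      ((Δ : ℝ) + 1) ^ 2 ≤ 1 / 2) :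
    pertZ (multivariateGaussian 0 Γ) (fun X ω => f X (ω + ψ)) 𝒳 ≠ 0 := by
  rw [← pertZ_cutoff]
  have hκ' : 0 ≤ κ * (1 + τ) := by positivity
  exact gaussian_setPertZ_ne_zero hΓ hΓop hdiag hγ hfr cell hdisj hv hRsymm hR hΔ hnbr (mul_nonneg hε (exp_pos _).le) hκ' hθ0 hθ1 hκθ
    (cutoff_shifted_measurable_sets cell 𝒳 hmeas ψ) (fun X hX1 ω => cutoff_shifted_reg cell hε hκ hτ 𝒳 hreg ψ hψ X hX1 ω)
    (fun X hX1 ω => cutoff_shifted_sup hε hκ hτ 𝒳 hsup ψ X hX1 ω) 𝒳 hconn hsmall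

/-- **THE STEP (ii) — THE NEXT POTENTIAL IS A SUM OF SUPPORT TERMS OVER THE CONNECTED CELL SETS OF `⋃𝒳`**:
`exp(Σ_{Y ∈ 𝒫(⋃𝒳)} K⁺_Y(ψ)) = Z_ψ(𝒳)`, `K⁺_Y(ψ) = Σ_{𝒞 ⊆ L, ⋃𝒞 = Y}Φ^T_ψ(𝒞)` with the activity `z_ψ = ⋃_*M_ψ`. [folklore] -/
theorem step_exp_sum_support {Γ : Matrix ι ι ℝ} {γop γ : ℝ} (hΓ : Γ.PosSemidef) (hΓop : (γop • (1 : Matrix ι ι ℝ) - Γ).PosSemidef)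
    (hdiag : ∀ i, Γ i i ≤ γ) (hγ : 0 ≤ γ) {dι : ι → ι → ℕ} {ρ : ℕ} (hfr : HasFiniteRange dι ρ Γ) (cell : V → Finset ι)
    (hdisj : ∀ p q, p ≠ q → Disjoint (cell p) (cell q)) {v : ℕ} (hv : ∀ p, (cell p).card ≤ v) (hRsymm : ∀ x y, R x y → R y x)
    (hR : ∀ (p p' : V) (x y : ι), x ∈ cell p → y ∈ cell p' → dι x y ≤ ρ → p = p' ∨ R p p')
    (hΔ : ∀ x, (nbr x).card ≤ Δ) (hnbr : ∀ x y, R x y → y ∈ nbr x)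
    {f : Finset V → EuclideanSpace ℝ ι → ℂ} {ε κ τ θ Ψ : ℝ} (hε : 0 ≤ ε) (hκ : 0 ≤ κ) (hτ : 0 < τ) (hθ0 : 0 < θ) (hθ1 : θ < 1)
    (hκθ : κ * (1 + τ) * γop ≤ θ) (𝒳 : Finset (Finset V)) (hconn : ∀ X ∈ 𝒳, IsRConnected R X)
    (hmeas : ∀ X ∈ 𝒳, Measurable[⨆ p ∈ X, MeasurableSpace.comap (fun (ω : EuclideanSpace ℝ ι) (x : cell p) => ω x) inferInstance] (f X))
    (hreg : ∀ X ∈ 𝒳, X.card = 1 → ∀ ω : EuclideanSpace ℝ ι, ‖f X ω‖ ≤ ε ^ X.card * exp (κ * (∑ x ∈ X.biUnion cell, ω x ^ 2) / 2))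
    (hsup : ∀ X ∈ 𝒳, X.card ≠ 1 → ∀ ω : EuclideanSpace ℝ ι, ‖f X ω‖ ≤ ε ^ X.card) (ψ : EuclideanSpace ℝ ι)
    (hψ : ∀ X ∈ 𝒳, X.card = 1 → ∑ x ∈ X.biUnion cell, ψ x ^ 2 ≤ Ψ ^ 2)
    (hsmall : Real.exp 1 * (Real.sqrt ((ε * exp (κ * (1 + τ⁻¹) * Ψ ^ 2 / 2)) * ((1 - θ) ^ (-(κ * (1 + τ) * γ / (2 * θ)))) ^ v) *
      Real.exp (2 * Real.sqrt ((ε * exp (κ * (1 + τ⁻¹) * Ψ ^ 2 / 2)) * ((1 - θ) ^ (-(κ * (1 + τ) * γ / (2 * θ)))) ^ v))) *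
      ((Δ : ℝ) + 1) ^ 2 ≤ 1 / 2) :
    Complex.exp (∑ Y ∈ rconnSubsets R (𝒳.biUnion id),
        ∑ 𝒞 ∈ ((rconnSubsets (Touches R) 𝒳).image fun 𝒜 => 𝒜.biUnion id).powerset with 𝒞.biUnion id = Y,
          truncatedWeight (GeomInc R) (pushforwardActivity (fun 𝒜 : Finset (Finset V) => 𝒜.biUnion id)
            (cellActivity (multivariateGaussian 0 Γ) fun X ω => f X (ω + ψ)) (rconnSubsets (Touches R) 𝒳)) 𝒞) =
      pertZ (multivariateGaussian 0 Γ) (fun X ω => f X (ω + ψ)) 𝒳 := by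
  have hκ' : 0 ≤ κ * (1 + τ) := by positivity
  -- the KP logarithm of the cut-off gas exponentiates to the cut-off partition function, which is `Z_ψ(𝒳)`
  have hexp := gaussian_exp_setLogZ hΓ hΓop hdiag hγ hfr cell hdisj hv hRsymm hR hΔ hnbr (mul_nonneg hε (exp_pos _).le) hκ' hθ0 hθ1 hκθ
    (cutoff_shifted_measurable_sets cell 𝒳 hmeas ψ) (fun X hX1 ω => cutoff_shifted_reg cell hε hκ hτ 𝒳 hreg ψ hψ X hX1 ω)
    (fun X hX1 ω => cutoff_shifted_sup hε hκ hτ 𝒳 hsup ψ X hX1 ω) 𝒳 hconn hsmall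
  rw [pertZ_cutoff] at hexp
  -- the cut-off activity IS `z_ψ`
  have hz : pushforwardActivity (fun 𝒜 : Finset (Finset V) => 𝒜.biUnion id)
      (cellActivity (multivariateGaussian 0 Γ) fun X ω => if X ∈ 𝒳 then f X (ω + ψ) else 0) (rconnSubsets (Touches R) 𝒳) =
      pushforwardActivity (fun 𝒜 : Finset (Finset V) => 𝒜.biUnion id)
        (cellActivity (multivariateGaussian 0 Γ) fun X ω => f X (ω + ψ)) (rconnSubsets (Touches R) 𝒳) :=
    funext fun Y => pushforward_cutoff (multivariateGaussian 0 Γ) (fun X ω => f X (ω + ψ)) 𝒳 Y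
  rw [hz] at hexp
  -- regroup the logarithm by support
  obtain ⟨hz0, hzb⟩ := shifted_pushforward_letters hΓ hΓop hdiag hγ cell hdisj hv hRsymm hΔ hnbr hε hκ hτ hθ0 hθ1 hκθ 𝒳 hconn hreg
    hsup ψ hψ hsmall
  rw [polymerLogZ_eq_sum_support hRsymm hΔ hnbr hz0 hzb (eps'_nonneg _) hsmall (image_biUnion_subset_rconn 𝒳 hconn)] at hexp
  exact hexp

omit [Fintype ι] [DecidableEq ι] in
/-- **THE STEP (iii) — THE OUTPUT TERMS ARE LOCAL IN THE EXTERNAL FIELD** (NO smallness needed): factors local in the field on their sets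
(`ψ = ψ'` on the cells of `X` ⟹ `f_X(ω+ψ) = f_X(ω+ψ')`), two fields EQUAL on the cells of `Y` ⟹ `K⁺_Y(ψ) = K⁺_Y(ψ')`. [folklore] -/
theorem step_supportTerm_local (μ : Measure (EuclideanSpace ℝ ι)) (cell : V → Finset ι) {f : Finset V → EuclideanSpace ℝ ι → ℂ}
    (𝒳 : Finset (Finset V))
    (hloc : ∀ X ∈ 𝒳, ∀ (ω ψ ψ' : EuclideanSpace ℝ ι), (∀ p ∈ X, ∀ x ∈ cell p, ψ x = ψ' x) → f X (ω + ψ) = f X (ω + ψ'))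
    {ψ ψ' : EuclideanSpace ℝ ι} (Y : Finset V) (hagree : ∀ p ∈ Y, ∀ x ∈ cell p, ψ x = ψ' x) :
    ∑ 𝒞 ∈ ((rconnSubsets (Touches R) 𝒳).image fun 𝒜 => 𝒜.biUnion id).powerset with 𝒞.biUnion id = Y,
        truncatedWeight (GeomInc R) (pushforwardActivity (fun 𝒜 : Finset (Finset V) => 𝒜.biUnion id)
          (cellActivity μ fun X ω => f X (ω + ψ)) (rconnSubsets (Touches R) 𝒳)) 𝒞 =
      ∑ 𝒞 ∈ ((rconnSubsets (Touches R) 𝒳).image fun 𝒜 => 𝒜.biUnion id).powerset with 𝒞.biUnion id = Y,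
        truncatedWeight (GeomInc R) (pushforwardActivity (fun 𝒜 : Finset (Finset V) => 𝒜.biUnion id)
          (cellActivity μ fun X ω => f X (ω + ψ')) (rconnSubsets (Touches R) 𝒳)) 𝒞 := by
  refine supportTerm_congr _ Y fun Y' _ hY'Y => pushforward_congr_of_agree 𝒳 Y' fun 𝒜 h𝒜 hU => ?_
  unfold cellActivity
  refine integral_congr_ae (ae_of_all _ fun ω => prod_congr rfl fun X hX => hloc X (h𝒜 hX) ω ψ ψ' fun p hp x hx => ?_)
  exact hagree p (hY'Y (hU ▸ mem_biUnion.2 ⟨X, hX, hp⟩)) x hx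

/-- **THE STEP (iv) — THE OUTPUT TERMS ARE EXPONENTIALLY SMALL IN THE SUPPORT** (activity letters only: no measurability, no range): `0 ≤ τ₂`,
`e^{1+τ₂}ε′(Δ+1)² ≤ 1∕2`, `Y` nonempty ⟹ `‖K⁺_Y(ψ)‖ ≤ e^{−τ₂#Y}·(Δ+1)·2e^{1+τ₂}ε′`. [folklore] -/
theorem step_norm_supportTerm_le {Γ : Matrix ι ι ℝ} {γop γ : ℝ} (hΓ : Γ.PosSemidef) (hΓop : (γop • (1 : Matrix ι ι ℝ) - Γ).PosSemidef)
    (hdiag : ∀ i, Γ i i ≤ γ) (hγ : 0 ≤ γ) (cell : V → Finset ι) (hdisj : ∀ p q, p ≠ q → Disjoint (cell p) (cell q)) {v : ℕ}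
    (hv : ∀ p, (cell p).card ≤ v) (hRsymm : ∀ x y, R x y → R y x) (hΔ : ∀ x, (nbr x).card ≤ Δ) (hnbr : ∀ x y, R x y → y ∈ nbr x)
    {f : Finset V → EuclideanSpace ℝ ι → ℂ} {ε κ τ θ Ψ : ℝ} (hε : 0 ≤ ε) (hκ : 0 ≤ κ) (hτ : 0 < τ)
    (hθ0 : 0 < θ) (hθ1 : θ < 1) (hκθ : κ * (1 + τ) * γop ≤ θ) (𝒳 : Finset (Finset V)) (hconn : ∀ X ∈ 𝒳, IsRConnected R X)
    (hreg : ∀ X ∈ 𝒳, X.card = 1 → ∀ ω : EuclideanSpace ℝ ι, ‖f X ω‖ ≤ ε ^ X.card * exp (κ * (∑ x ∈ X.biUnion cell, ω x ^ 2) / 2))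
    (hsup : ∀ X ∈ 𝒳, X.card ≠ 1 → ∀ ω : EuclideanSpace ℝ ι, ‖f X ω‖ ≤ ε ^ X.card) (ψ : EuclideanSpace ℝ ι)
    (hψ : ∀ X ∈ 𝒳, X.card = 1 → ∑ x ∈ X.biUnion cell, ψ x ^ 2 ≤ Ψ ^ 2) {τ₂ : ℝ} (hτ₂ : 0 ≤ τ₂)
    (hsmall : Real.exp (1 + τ₂) * (Real.sqrt ((ε * exp (κ * (1 + τ⁻¹) * Ψ ^ 2 / 2)) * ((1 - θ) ^ (-(κ * (1 + τ) * γ / (2 * θ)))) ^ v) *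
      Real.exp (2 * Real.sqrt ((ε * exp (κ * (1 + τ⁻¹) * Ψ ^ 2 / 2)) * ((1 - θ) ^ (-(κ * (1 + τ) * γ / (2 * θ)))) ^ v))) *
      ((Δ : ℝ) + 1) ^ 2 ≤ 1 / 2) {Y : Finset V} (hY : Y.Nonempty) :
    ‖∑ 𝒞 ∈ ((rconnSubsets (Touches R) 𝒳).image fun 𝒜 => 𝒜.biUnion id).powerset with 𝒞.biUnion id = Y,
        truncatedWeight (GeomInc R) (pushforwardActivity (fun 𝒜 : Finset (Finset V) => 𝒜.biUnion id)
          (cellActivity (multivariateGaussian 0 Γ) fun X ω => f X (ω + ψ)) (rconnSubsets (Touches R) 𝒳)) 𝒞‖ ≤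
      Real.exp (-(τ₂ * Y.card)) * (((Δ : ℝ) + 1) * (2 * (Real.exp (1 + τ₂) *
        (Real.sqrt ((ε * exp (κ * (1 + τ⁻¹) * Ψ ^ 2 / 2)) * ((1 - θ) ^ (-(κ * (1 + τ) * γ / (2 * θ)))) ^ v) *
          Real.exp (2 * Real.sqrt ((ε * exp (κ * (1 + τ⁻¹) * Ψ ^ 2 / 2)) * ((1 - θ) ^ (-(κ * (1 + τ) * γ / (2 * θ)))) ^ v)))))) := by
  obtain ⟨hz0, hzb⟩ := shifted_pushforward_letters hΓ hΓop hdiag hγ cell hdisj hv hRsymm hΔ hnbr hε hκ hτ hθ0 hθ1 hκθ 𝒳 hconn hreg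
    hsup ψ hψ (SupEffectiveActionLocalExpansion.smallness_of_decay (eps'_nonneg _) hτ₂ hsmall)
  exact norm_supportTerm_le hRsymm hΔ hnbr hz0 hzb (eps'_nonneg _) hτ₂ hsmall _ hY

/-- **THE STEP (v) — THE PINNED WEIGHTED NORM OF THE OUTPUT IS `O(ε′)`**: for every cell `p`,
`Σ_{Y ∈ 𝒫(⋃𝒳), p ∈ Y}‖K⁺_Y(ψ)‖·e^{τ₂#Y} ≤ (Δ+1)·2e^{1+τ₂}ε′`. [folklore] -/
theorem step_sum_norm_supportTerm_weighted_le {Γ : Matrix ι ι ℝ} {γop γ : ℝ} (hΓ : Γ.PosSemidef)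
    (hΓop : (γop • (1 : Matrix ι ι ℝ) - Γ).PosSemidef) (hdiag : ∀ i, Γ i i ≤ γ) (hγ : 0 ≤ γ) (cell : V → Finset ι)
    (hdisj : ∀ p q, p ≠ q → Disjoint (cell p) (cell q)) {v : ℕ} (hv : ∀ p, (cell p).card ≤ v) (hRsymm : ∀ x y, R x y → R y x)
    (hΔ : ∀ x, (nbr x).card ≤ Δ) (hnbr : ∀ x y, R x y → y ∈ nbr x)
    {f : Finset V → EuclideanSpace ℝ ι → ℂ} {ε κ τ θ Ψ : ℝ} (hε : 0 ≤ ε) (hκ : 0 ≤ κ) (hτ : 0 < τ)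
    (hθ0 : 0 < θ) (hθ1 : θ < 1) (hκθ : κ * (1 + τ) * γop ≤ θ) (𝒳 : Finset (Finset V)) (hconn : ∀ X ∈ 𝒳, IsRConnected R X)
    (hreg : ∀ X ∈ 𝒳, X.card = 1 → ∀ ω : EuclideanSpace ℝ ι, ‖f X ω‖ ≤ ε ^ X.card * exp (κ * (∑ x ∈ X.biUnion cell, ω x ^ 2) / 2))
    (hsup : ∀ X ∈ 𝒳, X.card ≠ 1 → ∀ ω : EuclideanSpace ℝ ι, ‖f X ω‖ ≤ ε ^ X.card) (ψ : EuclideanSpace ℝ ι)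
    (hψ : ∀ X ∈ 𝒳, X.card = 1 → ∑ x ∈ X.biUnion cell, ψ x ^ 2 ≤ Ψ ^ 2) {τ₂ : ℝ} (hτ₂ : 0 ≤ τ₂)
    (hsmall : Real.exp (1 + τ₂) * (Real.sqrt ((ε * exp (κ * (1 + τ⁻¹) * Ψ ^ 2 / 2)) * ((1 - θ) ^ (-(κ * (1 + τ) * γ / (2 * θ)))) ^ v) *
      Real.exp (2 * Real.sqrt ((ε * exp (κ * (1 + τ⁻¹) * Ψ ^ 2 / 2)) * ((1 - θ) ^ (-(κ * (1 + τ) * γ / (2 * θ)))) ^ v))) *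
      ((Δ : ℝ) + 1) ^ 2 ≤ 1 / 2) (p : V) :
    ∑ Y ∈ rconnSubsets R (𝒳.biUnion id) with p ∈ Y,
        ‖∑ 𝒞 ∈ ((rconnSubsets (Touches R) 𝒳).image fun 𝒜 => 𝒜.biUnion id).powerset with 𝒞.biUnion id = Y,
          truncatedWeight (GeomInc R) (pushforwardActivity (fun 𝒜 : Finset (Finset V) => 𝒜.biUnion id)
            (cellActivity (multivariateGaussian 0 Γ) fun X ω => f X (ω + ψ)) (rconnSubsets (Touches R) 𝒳)) 𝒞‖ * Real.exp (τ₂ * Y.card) ≤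
      ((Δ : ℝ) + 1) * (2 * (Real.exp (1 + τ₂) *
        (Real.sqrt ((ε * exp (κ * (1 + τ⁻¹) * Ψ ^ 2 / 2)) * ((1 - θ) ^ (-(κ * (1 + τ) * γ / (2 * θ)))) ^ v) *
          Real.exp (2 * Real.sqrt ((ε * exp (κ * (1 + τ⁻¹) * Ψ ^ 2 / 2)) * ((1 - θ) ^ (-(κ * (1 + τ) * γ / (2 * θ)))) ^ v))))) := by
  obtain ⟨hz0, hzb⟩ := shifted_pushforward_letters hΓ hΓop hdiag hγ cell hdisj hv hRsymm hΔ hnbr hε hκ hτ hθ0 hθ1 hκθ 𝒳 hconn hreg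
    hsup ψ hψ (SupEffectiveActionLocalExpansion.smallness_of_decay (eps'_nonneg _) hτ₂ hsmall)
  exact sum_norm_supportTerm_weighted_le hRsymm hΔ hnbr hz0 hzb (eps'_nonneg _) hτ₂ hsmall _ _ p

/-- **THE STEP (vi) — EXTENSIVITY OF THE NEXT POTENTIAL**: `‖Σ_{Y ∈ 𝒫(⋃𝒳)}K⁺_Y(ψ)‖ ≤ #(⋃𝒳)·(Δ+1)·2e·ε′`, uniformly in the volume and in such `ψ`.
[folklore] -/
theorem step_norm_sum_support_le {Γ : Matrix ι ι ℝ} {γop γ : ℝ} (hΓ : Γ.PosSemidef) (hΓop : (γop • (1 : Matrix ι ι ℝ) - Γ).PosSemidef)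
    (hdiag : ∀ i, Γ i i ≤ γ) (hγ : 0 ≤ γ) (cell : V → Finset ι) (hdisj : ∀ p q, p ≠ q → Disjoint (cell p) (cell q)) {v : ℕ}
    (hv : ∀ p, (cell p).card ≤ v) (hRsymm : ∀ x y, R x y → R y x) (hΔ : ∀ x, (nbr x).card ≤ Δ) (hnbr : ∀ x y, R x y → y ∈ nbr x)
    {f : Finset V → EuclideanSpace ℝ ι → ℂ} {ε κ τ θ Ψ : ℝ} (hε : 0 ≤ ε) (hκ : 0 ≤ κ) (hτ : 0 < τ)
    (hθ0 : 0 < θ) (hθ1 : θ < 1) (hκθ : κ * (1 + τ) * γop ≤ θ) (𝒳 : Finset (Finset V)) (hconn : ∀ X ∈ 𝒳, IsRConnected R X)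
    (hreg : ∀ X ∈ 𝒳, X.card = 1 → ∀ ω : EuclideanSpace ℝ ι, ‖f X ω‖ ≤ ε ^ X.card * exp (κ * (∑ x ∈ X.biUnion cell, ω x ^ 2) / 2))
    (hsup : ∀ X ∈ 𝒳, X.card ≠ 1 → ∀ ω : EuclideanSpace ℝ ι, ‖f X ω‖ ≤ ε ^ X.card) (ψ : EuclideanSpace ℝ ι)
    (hψ : ∀ X ∈ 𝒳, X.card = 1 → ∑ x ∈ X.biUnion cell, ψ x ^ 2 ≤ Ψ ^ 2)
    (hsmall : Real.exp 1 * (Real.sqrt ((ε * exp (κ * (1 + τ⁻¹) * Ψ ^ 2 / 2)) * ((1 - θ) ^ (-(κ * (1 + τ) * γ / (2 * θ)))) ^ v) *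
      Real.exp (2 * Real.sqrt ((ε * exp (κ * (1 + τ⁻¹) * Ψ ^ 2 / 2)) * ((1 - θ) ^ (-(κ * (1 + τ) * γ / (2 * θ)))) ^ v))) *
      ((Δ : ℝ) + 1) ^ 2 ≤ 1 / 2) :
    ‖∑ Y ∈ rconnSubsets R (𝒳.biUnion id),
        ∑ 𝒞 ∈ ((rconnSubsets (Touches R) 𝒳).image fun 𝒜 => 𝒜.biUnion id).powerset with 𝒞.biUnion id = Y,
          truncatedWeight (GeomInc R) (pushforwardActivity (fun 𝒜 : Finset (Finset V) => 𝒜.biUnion id)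
            (cellActivity (multivariateGaussian 0 Γ) fun X ω => f X (ω + ψ)) (rconnSubsets (Touches R) 𝒳)) 𝒞‖ ≤
      (𝒳.biUnion id).card * ((Δ : ℝ) + 1) * (2 * (Real.exp 1 *
        (Real.sqrt ((ε * exp (κ * (1 + τ⁻¹) * Ψ ^ 2 / 2)) * ((1 - θ) ^ (-(κ * (1 + τ) * γ / (2 * θ)))) ^ v) *
          Real.exp (2 * Real.sqrt ((ε * exp (κ * (1 + τ⁻¹) * Ψ ^ 2 / 2)) * ((1 - θ) ^ (-(κ * (1 + τ) * γ / (2 * θ)))) ^ v))))) := by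
  obtain ⟨hz0, hzb⟩ := shifted_pushforward_letters hΓ hΓop hdiag hγ cell hdisj hv hRsymm hΔ hnbr hε hκ hτ hθ0 hθ1 hκθ 𝒳 hconn hreg
    hsup ψ hψ hsmall
  rw [← polymerLogZ_eq_sum_support hRsymm hΔ hnbr hz0 hzb (eps'_nonneg _) hsmall (image_biUnion_subset_rconn 𝒳 hconn)]
  exact SupPolymerActivityExpansion.norm_polymerLogZ_le hRsymm hΔ hnbr hz0 hzb (eps'_nonneg _) hsmall (image_biUnion_subset_rconn 𝒳 hconn)

/-! ## §4. Toy -/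

/-- Toy (§2): with NO growth (`Ψ = 0`, `v = 0`) the activity parameter `ε″` is `ε·e^0·A^0 = ε ≥ 0`. -/
example {ε κ τ θ γ : ℝ} (hε : 0 ≤ ε) (hκ : 0 ≤ κ) (hτ : 0 < τ) (hγ : 0 ≤ γ) (hθ0 : 0 < θ) (hθ1 : θ < 1) :
    0 ≤ (ε * exp (κ * (1 + τ⁻¹) * (0 : ℝ) ^ 2 / 2)) * ((1 - θ) ^ (-(κ * (1 + τ) * γ / (2 * θ)))) ^ 0 :=
  eps''_nonneg hε hκ hτ hγ hθ0 hθ1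

end Summit.QuantumFields.BalabanUV.T4Continuum.NE7b.SupPolymerLocalStep
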